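import Literature.MathematicalPhysics.QuantumFieldTheory.Balaban1983to89.B6ScalarFactorsChartV1
import Literature.MathematicalPhysics.QuantumFieldTheory.Balaban1983to89.B6AgreeQaQV1Chart
import Literature.MathematicalPhysics.QuantumFieldTheory.Balaban1983to89.B9Cor35AtOneInverseLetters
import Literature.MathematicalPhysics.QuantumFieldTheory.Balaban1983to89.B8Eq12HodgeLaplacianV1

/-!
# `Balaban1983to89.B9Eq326AtOneChart` — T. Bałaban, *Propagators for lattice gauge theories in a background field*, Commun. Math.
# Phys. **99** (1985) 389–434 [Balaban1985BackgroundPropagators], (3.26) p. 395 AT `U = 1`: «Δ_a(U) = Δ(U) + D_U R(U) D*_U + Q*(U)aQ(U) …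
# It coincides with Δ_a in (2.19) if U = 1» — THE `U = 1` FACE OF (3.26) ASSEMBLED ENTRYWISE on the V1 global torus: r03's
# `onFun (deltaAE (domT hN D hk) c w)` ([4] = [Balaban1984PropagatorsII] (2.19) `Δ_a = ∂*∂ + ∂R∂* + Q*aQ`) as the SUM of three explicit
# lattice operators, the gauge-fixing projection `R` being p21's torus matrix `rM D = 1 − G′Q′*(Q′G′²Q′*)⁻¹Q′G′` ((2.17) = (3.25) at `U = 1`)
# read through the identity chart (`B6ScalarFactorsChartV1.chartOp`)

statement-level skeleton of published theorems with citation tags; proofs where landed; nothing here is a claim about the Yang–Mills mass gap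

PDF held: `paper:balaban1985-cmp99-background-propagators` pp. 392–395 (p0004–p0007 of the materialised text, read this seat 2026-08-27: (3.8)–(3.10),
(3.16), (3.21)–(3.26)); [4] `paper:balaban1984-cmp96-propagators-rt-ii` p. 225–226 ((2.17), (2.19)) through the tree's typed files.

CITATION HEADER (lean-in-tree rule).  Cell `pub-ymgap`, seat `dag-n06-g` g4 (bundle F2 of the N06 knit: the `U = 1` face of the letter `G(U) =
Δ_a(U)⁻¹`, rows 4–8 of `b9_main_of_up_view₁₁B10YZW_of_obligations`), lineage p463149/p465035 (`B9Cor35ComparisonsGA`), p468508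
(`B9Cor35ComparisonsGAAtLetters`), p473160 (`B9Cor35AtOneInverseLetters`); consumer = node00-def-Y's construction of the GENUINE bond-sector letter
`Δ_a(U)` (3.26)/(3.30) with `G(U) := Ring.inverse (Δ_a(U))`, whose interface clause `CovLettersY.GA_one` follows from the product-form clause
`Δ_a(1) (A ⊗ E) = (onFun (deltaAE …) A) ⊗ E` by `B9Cor35AtOneInverseLetters.GA_one_of_ringInverse_deltaA_one`.  WHAT IS REPRODUCED: the
sentence of p. 395 quoted in the title, as a DICTIONARY — the right-hand side of that product-form clause in the explicit shapes a covariant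
construction reduces to at `U = 1`.  INPUTS BY NAME (nothing restated): r03's `B6SectAOperatorsV1` (`dE ∂`, `dsE ∂*`, `dcE`/`dcsE` on vector
fields, `QE`/`QsE`, `aE`, `RE` = *"an orthogonal projection … onto the subspace ΔN(Q′)"*), `B6SectAVectorModelV1.deltaAE` ((2.19)) /`GE`,
`B6Prop26Census2136KLevelV1.Gop`; p22's `B6Dg288ChartV1.RE_eq_rM_chart` (V1's `R` IS p21's `1 − P` through the chart) and
`B6ScalarFactorsChartV1.chartOp` (+ `onFun_eq_chartOp`); p21's `B6Ineq288MultiLevelTorus` (`GT = gmlT`, `dP = mlOpT`, `QsM`, `QM`, `GiM`, `pM`, `rM`,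
`GiM_mul`, `G_mul_dP`/`dP_mul_G`); the kernels `B6AgreeLapV1Chart.toMatrix'_dcE/dcsE`, `B6AgreeQaQV1Chart.toMatrix'_QE`; g3's
`B9Cor35AtOneInverseLetters.isUnit_onFun_deltaAE`.

PRINT (p. 395, verbatim up to notation): *"Using the Lagrange multipliers method the minimum of (3.22) can be found by the same calculations as in
[4], (2.15)–(2.17), and we obtain the formula Rf = (I − G′Q′*(Q′G′²Q′*)⁻¹Q′G′)f, (3.25) where G′ = G′(U) = (Δ′_a)⁻¹. … We define Δ_a(U) = Δ(U) +
D_U R(U) D*_U + Q*(U)aQ(U), (3.26) or simply Δ_a = Δ + DRD* + Q*aQ. It coincides with Δ_a in (2.19) if U = 1."*  [4] p. 226: *"Δ_a = ∂*∂ + ∂R∂* +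
Q*aQ (2.19)"*.

## WHAT THIS FILE CERTIFIES (theorems only; 0 def, 0 sorry, standard axioms)

* §1 the `onFun` readings of r03's primitives ARE the lattice stencils (`onFun (dE c) = gradFn c`, `… dsE = divFn`, `… dcE = curlFn`, `… QE = qFn`,
  `… aE = diagFn`, all `rfl`) with their pointwise forms, and the two ADJOINTS in kernel form: `onFun_dcsE_apply` (the plaquette `∂*` = the `U = 1`
  face of (3.9): `(∂*F)(b) = Σ_p ∂(p, b)F(p)` with the four-indicator kernel of `toMatrix'_dcE`), `onFun_QsE_apply` (`(Q*ω)(b) = Σ_i Q(i, b)ω_i`),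
  `onFun_QaQ_apply` (`Q*aQ` pointwise);
* §2 `onFun_deltaAE_eq_three`: `onFun Δ_a = onFun ∂* ∘ curlFn + gradFn ∘ onFun R ∘ divFn + onFun Q* ∘ diagFn w ∘ qFn` for EVERY nested family `Dm`
  ((2.19) read on bond functions, the three summands separated);
* §3 on the V1 global torus (`hN`, `D : TDomains`, `hk`; `1 ≤ ℓ`, `1 ≤ M_h`, `1 ≤ P′_μ`, `c ≠ 0`): **`onFun_RE_eq_chartOp`** — `onFun (RE (domT hN D hk) c)
  = chartOp hN (rM D)` (the operator form of p22's pointwise `RE_eq_rM_chart`; `R` itself, not only `1 − R`), `onFun_RE_eq_onFun_RE` (independence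
  of `c`), `onFun_dE_RE_dsE_eq`/`_apply` (the middle summand `∂R∂* = gradFn c ∘ chartOp hN (rM D) ∘ divFn c`, pointwise
  `c·((rM·(∂*A ∘ chart⁻¹))(toBox b₊) − (rM·(∂*A ∘ chart⁻¹))(toBox b₋))`), ★ **`onFun_deltaAE_eq_chart`** / **`onFun_deltaAE_apply_chart`** (the
  whole of (2.19) = (3.26) at `U = 1` with the charted `R`, operator and pointwise forms);
* §4 the torus-side `Ring.inverse` faces of the (3.25) letters: `ringInverse_dP_eq_GT` (`G′ = Ring.inverse Δ′_a`), `ringInverse_QGGQs_eq_GiM`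
  (`(Q′G′²Q′*)⁻¹ = Ring.inverse (Q′G′²Q′*)` is p21's `GiM`), **`rM_eq_repr325`** (`rM D = 1 − G′·Q′*·Ring.inverse (Q′G′²Q′*)·Q′·G′` — (3.25) verbatim
  in p21's matrices, the shape of a letter `R(U) := 1 − G′(U)Q′(U)*·Ring.inverse (…)·Q′(U)G′(U)` at `U = 1`);
* §5 at the genuine k-level index `i : KIdx` (def-Y's carriers; the side conditions discharged from `i.hℓ`, `i.hM8`, `i.hP5`, `i.hcf`): `toKT_G_eq_GT`
  (`(toKT i).G = GT i.D`, `rfl`: the `G′` of the interface clause `Gp_one` IS the `G′` inside `rM`), ★★ **`onFun_RE_kIdx`**, ★★ **`onFun_deltaAE_kIdx`** /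
  **`onFun_deltaAE_kIdx_apply`**, `Gop_eq_ringInverse` (`Gop i = Ring.inverse (onFun Δ_a)`), and for the `C` letter ((3.48), clause `C_one`)
  `CinvTP_ker_eq_ringInverse` (T8's kernel `CinvTP (toKT i)` `= η^{−4−(d+1)}·Ring.inverse (Q′G′²Q′*)·diag(W⁻¹)` in p21's matrices);
* §6 (v1.1) `onFun_QE_apply_kernel`/`bondAvgIter_eq_kernel_sum` (`Q` as a kernel sum `(Q_jA)(β) = Σ_b Q(i,b)A(b)`).  (The plaquette `∂*` in print's `Σ_ν`
  form of (3.9) at `U = 1` is ALREADY `B8Eq12HodgeLaplacianV1.dcsE_apply` / `ofLp_dcsE_eq_covDivPlaq_one` with `LatticeFieldCalculus.covDivPlaq` — cited,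
  not restated.)
* §7 (v1.1) THE SOCKETS for node00-def-Y's letters: `deltaA_one_liftY_of_summands` (the product-form clause `Δ_a(1)(A ⊗ E) = (onFun Δ_a A) ⊗ E` from three
  summand clauses: flat `∂*∂`, charted `∂R∂*`, `Q*aQ`), ★★ **`GA_one_of_summands`** (then `G(U) := Ring.inverse (Δ_a(U))` satisfies `CovLettersY.GA_one`
  literally, via g3's `GA_one_of_ringInverse_deltaA_one`), ★★ **`C_one_of_ringInverse_QGGQs`** (`C(1) := η^{−4−(d+1)}·Ring.inverse (X(1)) ∘ diag(W⁻¹)♯`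
  with `X(1)(φ ⊗ E) = (QM·GT·GT·QsM φ) ⊗ E` satisfies `CovLettersY.C_one` literally);
* §8 (v1.1) ASSEMBLY SOCKETS from the `U = 1` clauses of the covariant PRIMITIVES: `curlAdjCurl_one_liftY_of_clauses` (summand 1 from flat curl + print's
  `Σ_ν` plaquette divergence = `B8Eq12HodgeLaplacianV1.dcsE_apply`), `dRds_one_liftY_of_clauses` (summand 2 from the charted gradient, `rM`, the charted
  divergence), `QGGQs_one_liftY_of_clauses` + `R_one_liftY_of_repr325` (`R(1)` from `Gp_one`, `Q′(1) = QM`, `Q′*(1) = QsM` and the `Ring.inverse` of the block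
  letter), `QaQ_one_liftY_of_clauses` (summand 3 from the straight averages, the weight and the transposed kernel); `liftY_sub`.

HONEST SCOPE.  Pure bookkeeping: no estimate of [B9]/[4] is asserted; every analytic input is r03's/p21's/p22's theorem cited by name.  The covariant
objects `Δ(U)`, `D_U`, `R(U)`, `Q(U)` of (3.10)/(3.19)/(3.25) are NOT constructed here (node00-def-Y's `Node00/OpsYDeltaA.lean`); this file fixes
only their `U = 1` targets.  Lattice units as in the cited files (fine factor `c`, p21's torus in units `1`; `R` is scale-free).  One finite `𝕋^{d+1}`
programme at fixed spacing — nothing about the continuum, OS axioms, a mass gap or the Clay problem.  Unit `pub-ymgap-dag-n06-g` (g4), 2026-08-27.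
-/

noncomputable section

open scoped BigOperators Matrix
open Finset

namespace Literature.MathematicalPhysics.QuantumFieldTheory.Balaban1983to89.B9Eq326AtOneChart

open LatticeFieldCalculus B6SectADomainsV1 B6SectAOntoV1
open B6SectAOperatorsV1 (ScalarSpace BondIdx dE dsE dcE dcsE QE QsE QpE aE RE gradFn divFn curlFn qFn qpFn diagFn dE_apply dsE_apply dcE_apply
  QE_apply QpE_apply aE_apply)
open B6SectAVectorModelV1 (deltaAE deltaAE_def GE)
open B6Ineq2133TwoScaleV1 (onFun onFun_apply onFun_onE)
open B6AgreeLapV1Chart (apply_eq_sum_toMatrix toMatrix'_onFun_adjoint toMatrix'_dcE toMatrix'_dcsE onFun_comp onFun_add)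
open B6AgreeQaQV1Chart (toMatrix'_QE)
open B4Reflection242 (boxDom)
open B6MultiLevelBoxOperator (N0)
open B6MultiLevelTorusOperator (TDomains)
open B6GlobalChartV1 (PV toBox boxEquiv domT)
open B6Dg288ChartV1 (RE_eq_rM_chart)
open B6Ineq288MultiLevelTorus (GT dP QsM QM GiM pM rM GiM_mul G_mul_dP dP_mul_G)
open B6ScalarFactorsChartV1 (chartOp chartOp_apply onFun_eq_chartOp)
open B6KLevelCensusIndexV1 (KIdx)
open B6Prop26Census2136KLevelV1 (Gop)
open B9Cor35AtOneInverseLetters (isUnit_onFun_deltaAE onFun_deltaAE_comp_Gop one_le_ell)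
open Node00 (toKT)

/-! ## §1  The `onFun` readings of the primitives of Sect. A of [4] are the lattice stencils; the two adjoints in kernel form -/

section Stencils

variable {P : Params} (Dm : Domains P)

/-- `∂` (sites → bonds) read on functions is the gradient stencil. [cite: Balaban1984PropagatorsII, (2.7) p.224; Balaban1985BackgroundPropagators, (3.3) p.390 (U = 1)] -/
theorem onFun_dE (c : ℝ) : onFun (dE (P := P) c) = gradFn c := rfl

/-- `∂*` (bonds → sites) read on functions is the divergence stencil (the `U = 1` face of (3.8)). [cite: Balaban1984PropagatorsII, (2.8) p.224; Balaban1985BackgroundPropagators, (3.8) p.392 (U = 1)] -/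
theorem onFun_dsE (c : ℝ) : onFun (dsE (P := P) c) = divFn c := rfl

/-- `∂` on vector fields (bonds → plaquettes) read on functions is the curl stencil (the `U = 1` face of the covariant `D` of (3.10)).
[cite: Balaban1984PropagatorsII, (2.5) p.224; Balaban1985BackgroundPropagators, (3.10) p.392 (U = 1)] -/
theorem onFun_dcE (c : ℝ) : onFun (dcE (P := P) c) = curlFn c := rfl

/-- the multi-scale `Q` read on functions (the `U = 1` face of `Q(U)` of (3.16)). [cite: Balaban1984PropagatorsII, (2.20) p.226; Balaban1985BackgroundPropagators, (3.16) p.393 (U = 1)] -/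
theorem onFun_QE : onFun (QE Dm) = qFn Dm := rfl

/-- the multi-scale `Q′` read on functions (the `U = 1` face of `Q′(U)` of (3.19)). [cite: Balaban1984PropagatorsII, (2.14) p.225; Balaban1985BackgroundPropagators, (3.19) p.393 (U = 1)] -/
theorem onFun_QpE : onFun (QpE Dm) = qpFn Dm := rfl

/-- the weight `a` read on functions is the diagonal operator. [cite: Balaban1984PropagatorsII, (2.18)–(2.20) p.226; Balaban1985BackgroundPropagators, (3.16) p.393] -/
theorem onFun_aE (w : BondIdx Dm → ℝ) : onFun (aE Dm w) = diagFn w := rfl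

/-- `(∂λ)(b) = c(λ(b₊) − λ(b₋))` on plain functions. [cite: Balaban1984PropagatorsII, (2.7) p.224; Balaban1985BackgroundPropagators, (3.3) p.390 (U = 1)] -/
theorem onFun_dE_apply (c : ℝ) (f : Site P 0 → ℝ) (b : PBond P 0) : onFun (dE c) f b = c * (f b.tgt - f b.src) := by
  rw [onFun_apply, dE_apply, WithLp.ofLp_toLp]
  unfold grad
  rw [smul_eq_mul]

/-- `(∂*A)(x) = Σ_μ c(A(x − e_μ, μ) − A(x, μ))` on plain functions (the `U = 1` face of (3.8)). [cite: Balaban1984PropagatorsII, (2.8) p.224; Balaban1985BackgroundPropagators, (3.8) p.392 (U = 1)] -/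
theorem onFun_dsE_apply (c : ℝ) (A : PBond P 0 → ℝ) (x : Site P 0) :
    onFun (dsE c) A x = ∑ μ : Fin P.d, c * (A ⟨x.unshift μ, μ⟩ - A ⟨x, μ⟩) := by
  rw [onFun_apply, dsE_apply, WithLp.ofLp_toLp]
  unfold diverg
  simp only [smul_eq_mul]

/-- `(∂A)(p) = c(A(x, μ) + A(x + e_μ, ν) − A(x + e_ν, μ) − A(x, ν))` on plain functions (the `U = 1` face of the covariant plaquette variable).
[cite: Balaban1984PropagatorsII, (2.5) p.224; Balaban1985BackgroundPropagators, (3.10) p.392 (U = 1)] -/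
theorem onFun_dcE_apply (c : ℝ) (A : PBond P 0 → ℝ) (p : Plaq P 0) :
    onFun (dcE c) A p = c * (A ⟨p.src, p.μ⟩ + A ⟨p.src.shift p.μ, p.ν⟩ - A ⟨p.src.shift p.ν, p.μ⟩ - A ⟨p.src, p.ν⟩) := by
  rw [onFun_apply, dcE_apply, WithLp.ofLp_toLp]
  unfold curl
  rw [smul_eq_mul]

/-- `(QA)(i) = (Q_jA)(β)` for the index bond `i = (j, β)`, on plain functions. [cite: Balaban1984PropagatorsII, (2.20) p.226; Balaban1985BackgroundPropagators, (3.15)–(3.16) p.393 (U = 1)] -/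
theorem onFun_QE_apply (A : PBond P 0 → ℝ) (i : BondIdx Dm) : onFun (QE Dm) A i = bondAvgIter (i.1.1 : ℕ) A i.1.2 := by
  rw [onFun_apply, QE_apply, WithLp.ofLp_toLp]

/-- `(aω)(i) = w_i ω_i` on plain functions. [cite: Balaban1984PropagatorsII, (2.18) p.226] -/
theorem onFun_aE_apply (w : BondIdx Dm → ℝ) (ω : BondIdx Dm → ℝ) (i : BondIdx Dm) : onFun (aE Dm w) ω i = w i * ω i := by
  rw [onFun_apply, aE_apply, WithLp.ofLp_toLp]

/-- **the plaquette `∂*` (plaquettes → bonds) in kernel form**: `(∂*F)(b) = Σ_p ∂(p, b)·F(p)` — the adjoint is the transpose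
(the `U = 1` face of the covariant `D*` of (3.9)). [cite: Balaban1984PropagatorsII, (2.19) p.226 («∂*∂»); Balaban1985BackgroundPropagators, (3.9) p.392 (U = 1)] -/
theorem onFun_dcsE_apply (c : ℝ) (F : Plaq P 0 → ℝ) (b : PBond P 0) :
    onFun (dcsE c) F b = ∑ p : Plaq P 0, LinearMap.toMatrix' (onFun (dcE (P := P) c)) p b * F p := by
  rw [apply_eq_sum_toMatrix, toMatrix'_dcsE]
  rfl

/-- **the plaquette `∂*` EXPLICITLY**: `(∂*F)(b) = c·Σ_p ([b = ⟨x,μ⟩] + [b = ⟨x+e_μ,ν⟩] − [b = ⟨x+e_ν,μ⟩] − [b = ⟨x,ν⟩])·F(p)`, `p = p_{μν}(x)` — i.e. the sum,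
over the plaquettes `p` having `b` on their boundary, of `±c·F(p)` with the orientation sign (the `U = 1` face of (3.9)).
[cite: Balaban1984PropagatorsII, (2.19) p.226; Balaban1985BackgroundPropagators, (3.9) p.392 (U = 1)] -/
theorem onFun_dcsE_apply_indicator (c : ℝ) (F : Plaq P 0 → ℝ) (b : PBond P 0) :
    onFun (dcsE c) F b = c * ∑ p : Plaq P 0,
      ((if (⟨p.src, p.μ⟩ : PBond P 0) = b then 1 else 0) + (if (⟨p.src.shift p.μ, p.ν⟩ : PBond P 0) = b then 1 else 0)
        - (if (⟨p.src.shift p.ν, p.μ⟩ : PBond P 0) = b then 1 else 0) - (if (⟨p.src, p.ν⟩ : PBond P 0) = b then 1 else 0)) * F p := by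
  rw [onFun_dcsE_apply, Finset.mul_sum]
  refine Finset.sum_congr rfl fun p _ => ?_
  rw [toMatrix'_dcE, mul_assoc]

/-- **`Q*` (index bonds → fine bonds) in kernel form**: `(Q*ω)(b) = Σ_i Q(i, b)·ω_i`, `Q(i, b) = (Q_jδ_b)(β)` (the adjoint is the transpose; the `U = 1`
face of `Q*(U)` of (3.16)). [cite: Balaban1984PropagatorsII, (2.18) p.226; Balaban1985BackgroundPropagators, (3.16) p.393 (U = 1)] -/
theorem onFun_QsE_apply (ω : BondIdx Dm → ℝ) (b : PBond P 0) :
    onFun (QsE Dm) ω b = ∑ i : BondIdx Dm, bondAvgIter (i.1.1 : ℕ) (Pi.single b (1 : ℝ)) i.1.2 * ω i := by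
  rw [apply_eq_sum_toMatrix]
  refine Finset.sum_congr rfl fun i _ => ?_
  rw [QsE, toMatrix'_onFun_adjoint, Matrix.transpose_apply, toMatrix'_QE]

/-- **`Q*aQ` pointwise**: `(Q*aQA)(b) = Σ_i Q(i, b)·w_i·(Q_jA)(β)` (the `U = 1` face of `Q*(U)aQ(U)` of (3.16)/(3.26)).
[cite: Balaban1984PropagatorsII, (2.18)–(2.20) p.226; Balaban1985BackgroundPropagators, (3.16) p.393, (3.26) p.395 (U = 1)] -/
theorem onFun_QaQ_apply (w : BondIdx Dm → ℝ) (A : PBond P 0 → ℝ) (b : PBond P 0) :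
    onFun (QsE Dm ∘ₗ aE Dm w ∘ₗ QE Dm) A b =
      ∑ i : BondIdx Dm, bondAvgIter (i.1.1 : ℕ) (Pi.single b (1 : ℝ)) i.1.2 * (w i * bondAvgIter (i.1.1 : ℕ) A i.1.2) := by
  rw [onFun_comp, onFun_comp, LinearMap.comp_apply, LinearMap.comp_apply, onFun_QsE_apply]
  refine Finset.sum_congr rfl fun i _ => ?_
  rw [onFun_aE_apply, onFun_QE_apply]

end Stencils

/-! ## §2  (2.19) read on bond functions, the three summands separated (every nested family) -/

section Three

variable {P : Params} (Dm : Domains P)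

/-- **`Δ_a = ∂*∂ + ∂R∂* + Q*aQ` READ ON BOND FUNCTIONS, SUMMAND BY SUMMAND**: `onFun Δ_a = onFun ∂* ∘ curl + grad ∘ onFun R ∘ div + onFun Q* ∘ a ∘ Q`
(the shape the three covariant summands of (3.26) reduce to at `U = 1`). [cite: Balaban1984PropagatorsII, (2.19) p.226; Balaban1985BackgroundPropagators, (3.26) p.395 («It coincides with Δ_a in (2.19) if U = 1»)] -/
theorem onFun_deltaAE_eq_three (c : ℝ) (w : BondIdx Dm → ℝ) :
    onFun (deltaAE Dm c w) =
      onFun (dcsE c) ∘ₗ curlFn c + gradFn c ∘ₗ onFun (RE Dm c) ∘ₗ divFn c + onFun (QsE Dm) ∘ₗ diagFn w ∘ₗ qFn Dm := by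
  rw [deltaAE_def, onFun_add, onFun_add, onFun_comp, onFun_comp, onFun_comp, onFun_comp, onFun_comp, onFun_dcE, onFun_dE, onFun_dsE,
    onFun_aE, onFun_QE]

/-- the same, pointwise at a fine bond, with the curl and `Q*aQ` summands explicit and `R` abstract.
[cite: Balaban1984PropagatorsII, (2.19) p.226; Balaban1985BackgroundPropagators, (3.26) p.395 (U = 1)] -/
theorem onFun_deltaAE_apply_three (c : ℝ) (w : BondIdx Dm → ℝ) (A : PBond P 0 → ℝ) (b : PBond P 0) :
    onFun (deltaAE Dm c w) A b =
      onFun (dcsE c) (curl c A) b + c * (onFun (RE Dm c) (diverg c A) b.tgt - onFun (RE Dm c) (diverg c A) b.src)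
        + ∑ i : BondIdx Dm, bondAvgIter (i.1.1 : ℕ) (Pi.single b (1 : ℝ)) i.1.2 * (w i * bondAvgIter (i.1.1 : ℕ) A i.1.2) := by
  have hQ := onFun_QaQ_apply Dm w A b
  rw [onFun_comp, onFun_comp, LinearMap.comp_apply, LinearMap.comp_apply] at hQ
  rw [onFun_deltaAE_eq_three]
  simp only [LinearMap.add_apply, LinearMap.comp_apply, Pi.add_apply]
  rw [← onFun_aE Dm w, ← onFun_QE Dm, hQ]
  congr 1

end Three

/-! ## §3  On the V1 global torus: `R` is p21's matrix `rM = 1 − G′Q′*(Q′G′²Q′*)⁻¹Q′G′` through the chart, and (3.26) at `U = 1` assembled -/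

section Chart

variable {d ℓ : ℕ} {m K : ℕ} {hd : 1 ≤ d + 1} {hL : Odd (ℓ + 1) ∧ 1 < ℓ + 1}
variable {Mh k R : ℕ} {P' : Fin (d + 1) → ℕ}
variable (hN : ∀ μ, N0 ℓ Mh k P' μ = (PV d ℓ m K hd hL).sitesPerDir 0) (D : TDomains d ℓ Mh k P' R) (hk : k ≤ m + K)

/-- **`R` OF (2.10)–(2.17) = (3.25) AT `U = 1`, AS AN OPERATOR ON PLAIN SITE FUNCTIONS, IS p21's TORUS MATRIX `rM D = 1 − G′Q′*(Q′G′²Q′*)⁻¹Q′G′` READ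
THROUGH THE CHART**: `onFun (RE (domT hN D hk) c) = chartOp hN (rM D)` (operator form of p22's pointwise `RE_eq_rM_chart`).
[cite: Balaban1984PropagatorsII, (2.17) p.225; Balaban1985BackgroundPropagators, (3.25) p.394 (U = 1)] -/
theorem onFun_RE_eq_chartOp (hℓ : 1 ≤ ℓ) (hMh : 1 ≤ Mh) (hP : ∀ μ, 1 ≤ P' μ) {c : ℝ} (hc : c ≠ 0) :
    onFun (RE (domT hN D hk) c) = chartOp hN (rM D) :=
  onFun_eq_chartOp hN fun f x => RE_eq_rM_chart hN D hk hℓ hMh hP hc f x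

/-- `R` does not depend on the fine factor `c ≠ 0` (it is the orthogonal projection onto `ΔN(Q′)`, and `Δ_c = c²Δ_1`).
[cite: Balaban1984PropagatorsII, (2.10)–(2.12) p.225; Balaban1985BackgroundPropagators, (3.21) p.394] -/
theorem onFun_RE_eq_onFun_RE (hℓ : 1 ≤ ℓ) (hMh : 1 ≤ Mh) (hP : ∀ μ, 1 ≤ P' μ) {c c' : ℝ} (hc : c ≠ 0) (hc' : c' ≠ 0) :
    onFun (RE (domT hN D hk) c) = onFun (RE (domT hN D hk) c') := by
  rw [onFun_RE_eq_chartOp hN D hk hℓ hMh hP hc, onFun_RE_eq_chartOp hN D hk hℓ hMh hP hc']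

/-- **THE GAUGE-FIXING SUMMAND `∂R∂*` ON BOND FUNCTIONS**: `onFun (∂ ∘ R ∘ ∂*) = grad_c ∘ chartOp (rM D) ∘ div_c` (the `U = 1` face of `D_U R(U) D*_U` of (3.26)).
[cite: Balaban1984PropagatorsII, (2.19) p.226; Balaban1985BackgroundPropagators, (3.26) p.395 (U = 1)] -/
theorem onFun_dE_RE_dsE_eq (hℓ : 1 ≤ ℓ) (hMh : 1 ≤ Mh) (hP : ∀ μ, 1 ≤ P' μ) {c : ℝ} (hc : c ≠ 0) :
    onFun (dE c ∘ₗ RE (domT hN D hk) c ∘ₗ dsE c) = gradFn c ∘ₗ chartOp hN (rM D) ∘ₗ divFn c := by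
  rw [onFun_comp, onFun_comp, onFun_RE_eq_chartOp hN D hk hℓ hMh hP hc, onFun_dE, onFun_dsE]

/-- `∂R∂*` pointwise: `(∂R∂*A)(b) = c·((rM·(∂*A ∘ chart⁻¹))(toBox b₊) − (rM·(∂*A ∘ chart⁻¹))(toBox b₋))`.
[cite: Balaban1984PropagatorsII, (2.19) p.226; Balaban1985BackgroundPropagators, (3.26) p.395 (U = 1)] -/
theorem onFun_dE_RE_dsE_apply (hℓ : 1 ≤ ℓ) (hMh : 1 ≤ Mh) (hP : ∀ μ, 1 ≤ P' μ) {c : ℝ} (hc : c ≠ 0)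
    (A : PBond (PV d ℓ m K hd hL) 0 → ℝ) (b : PBond (PV d ℓ m K hd hL) 0) :
    onFun (dE c ∘ₗ RE (domT hN D hk) c ∘ₗ dsE c) A b =
      c * ((rM D *ᵥ fun z => diverg c A ((boxEquiv hN).symm z)) (toBox hN b.tgt)
        - (rM D *ᵥ fun z => diverg c A ((boxEquiv hN).symm z)) (toBox hN b.src)) := by
  rw [onFun_dE_RE_dsE_eq hN D hk hℓ hMh hP hc, LinearMap.comp_apply, LinearMap.comp_apply]
  show c • (chartOp hN (rM D) (divFn c A) b.tgt - chartOp hN (rM D) (divFn c A) b.src) = _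
  rw [chartOp_apply, chartOp_apply, smul_eq_mul]
  rfl

/-- ★ **(3.26) AT `U = 1` = (2.19) ON THE V1 GLOBAL TORUS, ASSEMBLED (operator form)**: `onFun Δ_a = onFun ∂* ∘ curl_c + grad_c ∘ chartOp (rM D) ∘ div_c +
onFun Q* ∘ a ∘ Q` — the three `U = 1` targets of the covariant summands `Δ(U)`, `D_U R(U) D*_U`, `Q*(U)aQ(U)`.
[cite: Balaban1985BackgroundPropagators, (3.26) p.395 («It coincides with Δ_a in (2.19) if U = 1»); Balaban1984PropagatorsII, (2.17) p.225, (2.19) p.226] -/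
theorem onFun_deltaAE_eq_chart (hℓ : 1 ≤ ℓ) (hMh : 1 ≤ Mh) (hP : ∀ μ, 1 ≤ P' μ) {c : ℝ} (hc : c ≠ 0)
    (w : BondIdx (domT hN D hk) → ℝ) :
    onFun (deltaAE (domT hN D hk) c w) =
      onFun (dcsE c) ∘ₗ curlFn c + gradFn c ∘ₗ chartOp hN (rM D) ∘ₗ divFn c
        + onFun (QsE (domT hN D hk)) ∘ₗ diagFn w ∘ₗ qFn (domT hN D hk) := by
  rw [onFun_deltaAE_eq_three, onFun_RE_eq_chartOp hN D hk hℓ hMh hP hc]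

/-- ★ **(3.26) AT `U = 1`, POINTWISE AT A FINE BOND**: `(Δ_aA)(b) = (∂*(∂A))(b) + c·((rM·(∂*A∘chart⁻¹))(toBox b₊) − (rM·(∂*A∘chart⁻¹))(toBox b₋)) +
Σ_i Q(i,b)·w_i·(Q_jA)(β)`. [cite: Balaban1985BackgroundPropagators, (3.26) p.395 (U = 1); Balaban1984PropagatorsII, (2.17) p.225, (2.19) p.226] -/
theorem onFun_deltaAE_apply_chart (hℓ : 1 ≤ ℓ) (hMh : 1 ≤ Mh) (hP : ∀ μ, 1 ≤ P' μ) {c : ℝ} (hc : c ≠ 0)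
    (w : BondIdx (domT hN D hk) → ℝ) (A : PBond (PV d ℓ m K hd hL) 0 → ℝ) (b : PBond (PV d ℓ m K hd hL) 0) :
    onFun (deltaAE (domT hN D hk) c w) A b =
      onFun (dcsE c) (curl c A) b
        + c * ((rM D *ᵥ fun z => diverg c A ((boxEquiv hN).symm z)) (toBox hN b.tgt)
            - (rM D *ᵥ fun z => diverg c A ((boxEquiv hN).symm z)) (toBox hN b.src))
        + ∑ i : BondIdx (domT hN D hk), bondAvgIter (i.1.1 : ℕ) (Pi.single b (1 : ℝ)) i.1.2 * (w i * bondAvgIter (i.1.1 : ℕ) A i.1.2) := by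
  rw [onFun_deltaAE_apply_three, ← onFun_dE_RE_dsE_apply hN D hk hℓ hMh hP hc A b, onFun_comp, onFun_comp, LinearMap.comp_apply,
    LinearMap.comp_apply, onFun_dE_apply]
  rfl

end Chart

/-! ## §4  The torus-side `Ring.inverse` faces of the (3.25) letters -/

section Torus

variable {d ℓ : ℕ} {Mh k R : ℕ} {P' : Fin (d + 1) → ℕ} (D : TDomains d ℓ Mh k P' R)

/-- `G′ = (Δ′_a)⁻¹` on the torus as a `Ring.inverse`: `Ring.inverse (dP D) = GT D` (the `U = 1` face of `G′(U) := Ring.inverse (Δ′_a(U))`).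
[cite: Balaban1984PropagatorsII, (2.13) p.225 («G′ = Δ′_a⁻¹»); Balaban1985BackgroundPropagators, (3.25) p.394 («G′ = G′(U) = (Δ′_a)⁻¹»)] -/
theorem ringInverse_dP_eq_GT (hℓ : 1 ≤ ℓ) (hMh : 1 ≤ Mh) (hP : ∀ μ, 1 ≤ P' μ) : Ring.inverse (dP D) = GT D := by
  have hu : IsUnit (dP D) := isUnit_iff_exists.2 ⟨GT D, dP_mul_G D hℓ hMh hP, G_mul_dP D hℓ hMh hP⟩
  calc Ring.inverse (dP D) = Ring.inverse (dP D) * (dP D * GT D) := by rw [dP_mul_G D hℓ hMh hP, mul_one]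
    _ = Ring.inverse (dP D) * dP D * GT D := (mul_assoc _ _ _).symm
    _ = GT D := by rw [Ring.inverse_mul_cancel _ hu, one_mul]

/-- `(Q′G′²Q′*)⁻¹` on the torus as a `Ring.inverse`: `Ring.inverse (QM·GT·GT·QsM) = GiM D` (p21's inverse `GinvT`; the `U = 1` face of a letter
`Ring.inverse (Q′(U)G′(U)²Q′(U)*)`). [cite: Balaban1984PropagatorsII, (2.17) p.225, Prop. 2.3 p.238 («an inverse of the operator Q′G′²Q′*»); Balaban1985BackgroundPropagators, (3.25) p.394] -/
theorem ringInverse_QGGQs_eq_GiM (hℓ : 1 ≤ ℓ) (hMh : 1 ≤ Mh) (hP : ∀ μ, 1 ≤ P' μ) :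
    Ring.inverse (QM D * GT D * GT D * QsM D) = GiM D := by
  have h := GiM_mul D hℓ hMh hP
  have hu : IsUnit (QM D * GT D * GT D * QsM D) := isUnit_iff_exists.2 ⟨GiM D, h.2, h.1⟩
  calc Ring.inverse (QM D * GT D * GT D * QsM D)
      = Ring.inverse (QM D * GT D * GT D * QsM D) * ((QM D * GT D * GT D * QsM D) * GiM D) := by rw [h.2, mul_one]
    _ = Ring.inverse (QM D * GT D * GT D * QsM D) * (QM D * GT D * GT D * QsM D) * GiM D := (mul_assoc _ _ _).symm
    _ = GiM D := by rw [Ring.inverse_mul_cancel _ hu, one_mul]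

/-- **(3.25) VERBATIM IN p21's TORUS MATRICES**: `rM D = 1 − G′·Q′*·Ring.inverse (Q′G′²Q′*)·Q′·G′` — the `U = 1` shape of a covariant letter
`R(U) := 1 − G′(U)Q′(U)*·Ring.inverse (Q′(U)G′(U)²Q′(U)*)·Q′(U)G′(U)`. [cite: Balaban1985BackgroundPropagators, (3.25) p.394; Balaban1984PropagatorsII, (2.17) p.225] -/
theorem rM_eq_repr325 (hℓ : 1 ≤ ℓ) (hMh : 1 ≤ Mh) (hP : ∀ μ, 1 ≤ P' μ) :
    rM D = 1 - GT D * QsM D * Ring.inverse (QM D * GT D * GT D * QsM D) * QM D * GT D := by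
  rw [ringInverse_QGGQs_eq_GiM D hℓ hMh hP]
  rfl

end Torus

/-! ## §5  At the genuine k-level index `i : KIdx` (def-Y's carriers), side conditions discharged -/

section Index

variable {d ℓ : ℕ} {hd : 1 ≤ d + 1} {hL : Odd (ℓ + 1) ∧ 1 < ℓ + 1} {b₀ b₁ : ℝ} (i : KIdx d ℓ hd hL b₀ b₁)

/-- the `G′` of the interface clause `CovLettersY.Gp_one` (`(toKT i).G`) IS the `G′ = gmlT` inside p21's `rM`/`pM` at the index's torus data.
[cite: Balaban1984PropagatorsII, (2.17) p.225, dictionary] -/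
theorem toKT_G_eq_GT : (toKT i).G = GT i.D := rfl

/-- ★★ **`R` AT THE INDEX**: `onFun (RE (domT i.hN i.D i.hk) i.cf) = chartOp i.hN (rM i.D)` (no side condition left: `ℓ ≥ 4`, `M_h ≥ 8`, `P′ ≥ 5`, `c_f ≠ 0`
are fields of the index). [cite: Balaban1984PropagatorsII, (2.17) p.225; Balaban1985BackgroundPropagators, (3.25) p.394 (U = 1)] -/
theorem onFun_RE_kIdx : onFun (RE (domT i.hN i.D i.hk) i.cf) = chartOp i.hN (rM i.D) :=
  onFun_RE_eq_chartOp i.hN i.D i.hk (one_le_ell i) (toKT i).hMh (toKT i).hP i.hcf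

/-- ★★ **(3.26) AT `U = 1` AT THE INDEX (operator form)** — the right-hand side of the product-form clause `Δ_a(1)(A ⊗ E) = (onFun Δ_a A) ⊗ E` consumed by
`B9Cor35AtOneInverseLetters.GA_one_of_ringInverse_deltaA_one`, as three explicit operators on `FBondY i → ℝ`.
[cite: Balaban1985BackgroundPropagators, (3.26) p.395 («It coincides with Δ_a in (2.19) if U = 1»); Balaban1984PropagatorsII, (2.19) p.226] -/
theorem onFun_deltaAE_kIdx :
    onFun (deltaAE (domT i.hN i.D i.hk) i.cf i.w) =
      onFun (dcsE i.cf) ∘ₗ curlFn i.cf + gradFn i.cf ∘ₗ chartOp i.hN (rM i.D) ∘ₗ divFn i.cf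
        + onFun (QsE (domT i.hN i.D i.hk)) ∘ₗ diagFn i.w ∘ₗ qFn (domT i.hN i.D i.hk) :=
  onFun_deltaAE_eq_chart i.hN i.D i.hk (one_le_ell i) (toKT i).hMh (toKT i).hP i.hcf i.w

/-- ★★ **(3.26) AT `U = 1` AT THE INDEX, POINTWISE AT A FINE BOND.** [cite: Balaban1985BackgroundPropagators, (3.26) p.395 (U = 1); Balaban1984PropagatorsII, (2.19) p.226] -/
theorem onFun_deltaAE_kIdx_apply (A : PBond (PV d ℓ i.m i.K hd hL) 0 → ℝ) (b : PBond (PV d ℓ i.m i.K hd hL) 0) :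
    onFun (deltaAE (domT i.hN i.D i.hk) i.cf i.w) A b =
      onFun (dcsE i.cf) (curl i.cf A) b
        + i.cf * ((rM i.D *ᵥ fun z => diverg i.cf A ((boxEquiv i.hN).symm z)) (toBox i.hN b.tgt)
            - (rM i.D *ᵥ fun z => diverg i.cf A ((boxEquiv i.hN).symm z)) (toBox i.hN b.src))
        + ∑ n : BondIdx (domT i.hN i.D i.hk),
            bondAvgIter (n.1.1 : ℕ) (Pi.single b (1 : ℝ)) n.1.2 * (i.w n * bondAvgIter (n.1.1 : ℕ) A n.1.2) :=
  onFun_deltaAE_apply_chart i.hN i.D i.hk (one_le_ell i) (toKT i).hMh (toKT i).hP i.hcf i.w A b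

/-- **`G = Δ_a⁻¹` AS A `Ring.inverse`**: r03's `Gop i = Ring.inverse (onFun Δ_a)` (the `U = 1` value of a letter `G(U) := Ring.inverse (Δ_a(U))` whose
`Δ_a(1)` lifts `onFun Δ_a`). [cite: Balaban1984PropagatorsII, (2.22) p.226 («G = Δ_a⁻¹»); Balaban1985BackgroundPropagators, (3.27) p.395 (U = 1)] -/
theorem Gop_eq_ringInverse : Gop i = Ring.inverse (onFun (deltaAE (domT i.hN i.D i.hk) i.cf i.w)) := by
  have hu := isUnit_onFun_deltaAE i
  have h1 : onFun (deltaAE (domT i.hN i.D i.hk) i.cf i.w) * Gop i = 1 := by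
    rw [Module.End.mul_eq_comp, Module.End.one_eq_id]
    exact onFun_deltaAE_comp_Gop i
  calc Gop i = Ring.inverse (onFun (deltaAE (domT i.hN i.D i.hk) i.cf i.w)) * onFun (deltaAE (domT i.hN i.D i.hk) i.cf i.w) * Gop i := by
        rw [Ring.inverse_mul_cancel _ hu, one_mul]
    _ = Ring.inverse (onFun (deltaAE (domT i.hN i.D i.hk) i.cf i.w)) * (onFun (deltaAE (domT i.hN i.D i.hk) i.cf i.w) * Gop i) :=
        mul_assoc _ _ _
    _ = Ring.inverse (onFun (deltaAE (domT i.hN i.D i.hk) i.cf i.w)) := by rw [h1, mul_one]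

/-- **THE `C` LETTER'S `U = 1` KERNEL AS A `Ring.inverse`** (the clause `CovLettersY.C_one` reads T8's `CinvTP (toKT i)`): as a matrix on the blocks,
`CinvTP.ker = η^{−4−(d+1)} · Ring.inverse (Q′G′²Q′*) · diag(W⁻¹)` with p21's torus letters (`η⁻¹ = L^k = nKT`, `W(y′) = (L^{j′})^{d+1}` the block volume
turning an operator matrix into print's kernel) — the `U = 1` shape of a covariant letter `C(U) := η^{−4−(d+1)} · Ring.inverse (Q′(U)G′(U)²Q′(U)*) · diag(W⁻¹)`
((3.48) `(Q′G′²Q′*)⁻¹`). [cite: Balaban1985BackgroundPropagators, (3.48) p.398; Balaban1984PropagatorsII, Prop. 2.3 (2.86)–(2.87) p.238] -/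
theorem CinvTP_ker_eq_ringInverse :
    Matrix.of (B6Prop23KLevelTorusCensus.CinvTP (toKT i)).ker =
      ((((B6Prop22KLevelTorusCensusEta.nKT (toKT i) : ℕ) : ℝ)) ^ (4 + (d + 1))) •
        (Ring.inverse (QM i.D * GT i.D * GT i.D * QsM i.D) * Matrix.diagonal fun y => (B6Ineq268MultiLevelBox.W i.D.toDomains y)⁻¹) := by
  rw [ringInverse_QGGQs_eq_GiM i.D (one_le_ell i) (toKT i).hMh (toKT i).hP]
  ext y y'
  rw [Matrix.of_apply, B6Prop23KLevelTorusCensus.CinvTP_ker, Matrix.smul_apply, Matrix.mul_diagonal, smul_eq_mul, div_eq_mul_inv]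
  rfl

end Index

/-! ## §6 (v1.1)  `Q` as a kernel sum (the plaquette `∂*` in print's `Σ_ν` form of (3.9) is `B8Eq12HodgeLaplacianV1.dcsE_apply`, cited not restated) -/

section Kernel

variable {P : Params} (Dm : Domains P)

/-- **`Q` AS A KERNEL SUM**: `(Q_jA)(β) = Σ_b Q(i, b)·A(b)`, `Q(i, b) = (Q_jδ_b)(β)` — the shape a covariant averaging `Q(U)` given by a transported kernel reduces to
at `U = 1`. [cite: Balaban1984PropagatorsII, (2.20) p.226; Balaban1985BackgroundPropagators, (3.15)–(3.16) p.393 (U = 1)] -/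
theorem onFun_QE_apply_kernel (A : PBond P 0 → ℝ) (i : BondIdx Dm) :
    onFun (QE Dm) A i = ∑ b : PBond P 0, bondAvgIter (i.1.1 : ℕ) (Pi.single b (1 : ℝ)) i.1.2 * A b := by
  rw [apply_eq_sum_toMatrix]
  exact Finset.sum_congr rfl fun b _ => by rw [toMatrix'_QE]

/-- `(Q_jA)(β)` itself as the kernel sum (plain functions, no `onFun`). [cite: Balaban1984PropagatorsII, (2.20) p.226, bookkeeping] -/
theorem bondAvgIter_eq_kernel_sum (A : PBond P 0 → ℝ) (i : BondIdx Dm) :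
    bondAvgIter (i.1.1 : ℕ) A i.1.2 = ∑ b : PBond P 0, bondAvgIter (i.1.1 : ℕ) (Pi.single b (1 : ℝ)) i.1.2 * A b := by
  rw [← onFun_QE_apply Dm A i, onFun_QE_apply_kernel]

end Kernel

/-! ## §7 (v1.1)  The SOCKETS for node00-def-Y's letters: `GA_one` from three summand clauses at `U = 1`; `C_one` from the `Ring.inverse` of the block
letter `Q′G′²Q′*` -/

section Sockets

open Node00 (liftY liftY_apply liftOpY liftOpY_liftY deltaY kernelOpY kernelOpY_deltaY FBondY BlkY CfgY BondOpY)
open B9Cor35AtOneInverseLetters (GA_one_of_ringInverse_deltaA_one eq_liftOpY_of_ringInverse liftOpY_mul)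

variable {𝔸 : Type} [NormedRing 𝔸] [NormedAlgebra ℂ 𝔸] [CompleteSpace 𝔸]
variable {d ℓ : ℕ} {hd : 1 ≤ d + 1} {hL : Odd (ℓ + 1) ∧ 1 < ℓ + 1} {b₀ b₁ : ℝ} (i : KIdx d ℓ hd hL b₀ b₁)

/-- ★ **THE PRODUCT-FORM CLAUSE OF `Δ_a(1)` FROM THREE SUMMAND CLAUSES.**  If a bond-sector letter `Δ` (the candidate `Δ_a(U)` of (3.26)) splits at `U = 1` as
`Δ(1) = Δ₁ + Δ₂ + Δ₃` with `Δ₁` acting on product forms as the flat `∂*∂` (`onFun (dcsE c_f) ∘ curlFn c_f` — the `U = 1` face of `Δ(U)`), `Δ₂` as the charted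
`∂R∂*` (`gradFn c_f ∘ chartOp i.hN (rM i.D) ∘ divFn c_f` — the `U = 1` face of `D_U R(U) D*_U`) and `Δ₃` as `Q*aQ` (`onFun Q* ∘ diagFn w ∘ qFn` — the
`U = 1` face of `Q*(U)aQ(U)`), then `Δ(1)(A ⊗ E) = (onFun Δ_a A) ⊗ E` — the hypothesis `hΔ` of `B9Cor35AtOneInverseLetters.GA_one_of_ringInverse_deltaA_one`.
[cite: Balaban1985BackgroundPropagators, (3.26) p.395 («It coincides with Δ_a in (2.19) if U = 1»); Balaban1984PropagatorsII, (2.19) p.226] -/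
theorem deltaA_one_liftY_of_summands (Δ : BondOpY 𝔸 i) (Δ₁ Δ₂ Δ₃ : (FBondY i → 𝔸) →ₗ[ℂ] (FBondY i → 𝔸))
    (hΔ : Δ (fun _ _ => 1) = Δ₁ + Δ₂ + Δ₃)
    (h₁ : ∀ (A : FBondY i → ℝ) (E : 𝔸), Δ₁ (liftY A E) = liftY ((onFun (dcsE i.cf) ∘ₗ curlFn i.cf) A) E)
    (h₂ : ∀ (A : FBondY i → ℝ) (E : 𝔸), Δ₂ (liftY A E) = liftY ((gradFn i.cf ∘ₗ chartOp i.hN (rM i.D) ∘ₗ divFn i.cf) A) E)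
    (h₃ : ∀ (A : FBondY i → ℝ) (E : 𝔸),
      Δ₃ (liftY A E) = liftY ((onFun (QsE (domT i.hN i.D i.hk)) ∘ₗ diagFn i.w ∘ₗ qFn (domT i.hN i.D i.hk)) A) E) :
    ∀ (A : FBondY i → ℝ) (E : 𝔸), Δ (fun _ _ => 1) (liftY A E) = liftY (onFun (deltaAE (domT i.hN i.D i.hk) i.cf i.w) A) E := by
  intro A E
  rw [hΔ, LinearMap.add_apply, LinearMap.add_apply, h₁, h₂, h₃, onFun_deltaAE_kIdx, LinearMap.add_apply, LinearMap.add_apply]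
  funext b
  simp only [Pi.add_apply, liftY_apply, Complex.ofReal_add, add_smul]

/-- ★★ **THE `GA_one` SOCKET**: a letter `G(U) := Ring.inverse (Δ_a(U))` whose `Δ_a(1)` splits into three summands with the three flat clauses above
satisfies the interface clause `Node00.CovLettersY.GA_one` LITERALLY (`G(1)(J ⊗ E) = (Gop i J) ⊗ E`, r03's genuine `G = Δ_a⁻¹`).
[cite: Balaban1985BackgroundPropagators, (3.26)–(3.27) p.395 + Cor. 3.5 p.407; Balaban1984PropagatorsII, (2.19), (2.22) p.226] -/
theorem GA_one_of_summands (O Δ : BondOpY 𝔸 i) (Δ₁ Δ₂ Δ₃ : (FBondY i → 𝔸) →ₗ[ℂ] (FBondY i → 𝔸))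
    (hO : O (fun _ _ => 1) = Ring.inverse (Δ (fun _ _ => 1)))
    (hΔ : Δ (fun _ _ => 1) = Δ₁ + Δ₂ + Δ₃)
    (h₁ : ∀ (A : FBondY i → ℝ) (E : 𝔸), Δ₁ (liftY A E) = liftY ((onFun (dcsE i.cf) ∘ₗ curlFn i.cf) A) E)
    (h₂ : ∀ (A : FBondY i → ℝ) (E : 𝔸), Δ₂ (liftY A E) = liftY ((gradFn i.cf ∘ₗ chartOp i.hN (rM i.D) ∘ₗ divFn i.cf) A) E)
    (h₃ : ∀ (A : FBondY i → ℝ) (E : 𝔸),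
      Δ₃ (liftY A E) = liftY ((onFun (QsE (domT i.hN i.D i.hk)) ∘ₗ diagFn i.w ∘ₗ qFn (domT i.hN i.D i.hk)) A) E) :
    ∀ (J : FBondY i → ℝ) (E : 𝔸), O (fun _ _ => 1) (liftY J E) = liftY (Gop i J) E :=
  GA_one_of_ringInverse_deltaA_one i O Δ hO (deltaA_one_liftY_of_summands i Δ Δ₁ Δ₂ Δ₃ hΔ h₁ h₂ h₃)

/-- ★★ **THE `C_one` SOCKET** ((3.48) `(Q′G′²Q′*)⁻¹` read as T8's kernel): if a block letter `X(U)` (the candidate `Q′(U)G′(U)²Q′(U)*`) acts at `U = 1` on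
product forms as p21's matrix `QM·GT·GT·QsM` (block average `Q′` = `QM`, block-constant extension `Q′*` = `QsM`, `G′ = GT = gmlT`), then the letter
`C(1) := η^{−4−(d+1)} · Ring.inverse (X(1)) ∘ diag(W⁻¹)♯` (`η⁻¹ = L^k = nKT`, `W(y) = (L^j)^{d+1}`) satisfies the interface clause `Node00.CovLettersY.C_one`
LITERALLY: `C(1)(δ_{s′} ⊗ E)(s) = CinvTP.ker(s, s′)·E`. [cite: Balaban1985BackgroundPropagators, (3.48) p.398; Balaban1984PropagatorsII, (2.17) p.225, Prop. 2.3 (2.86)–(2.87) p.238] -/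
theorem C_one_of_ringInverse_QGGQs (Cl X : CfgY 𝔸 i → (BlkY i → 𝔸) →ₗ[ℂ] (BlkY i → 𝔸))
    (hX : ∀ (φ : BlkY i → ℝ) (E : 𝔸), X (fun _ _ => 1) (liftY φ E) = liftY ((QM i.D * GT i.D * GT i.D * QsM i.D) *ᵥ φ) E)
    (hC : Cl (fun _ _ => 1) =
      ((((B6Prop22KLevelTorusCensusEta.nKT (toKT i) : ℕ) : ℝ) ^ (4 + (d + 1)) : ℝ) : ℂ) •
        (Ring.inverse (X (fun _ _ => 1)) ∘ₗ liftOpY 𝔸 (Matrix.diagonal fun y => (B6Ineq268MultiLevelBox.W i.D.toDomains y)⁻¹))) :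
    ∀ (s s' : BlkY i) (E : 𝔸),
      Cl (fun _ _ => 1) (deltaY s' E) s = (((B6Prop23KLevelTorusCensus.CinvTP (toKT i)).ker s s' : ℝ) : ℂ) • E := by
  intro s s' E
  have hR : Ring.inverse (X (fun _ _ => 1)) = liftOpY 𝔸 (GiM i.D) :=
    eq_liftOpY_of_ringInverse rfl (GiM_mul i.D (one_le_ell i) (toKT i).hMh (toKT i).hP).2 hX
  have hker : (B6Prop23KLevelTorusCensus.CinvTP (toKT i)).ker s s' =
      (((B6Prop22KLevelTorusCensusEta.nKT (toKT i) : ℕ) : ℝ)) ^ (4 + (d + 1)) *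
        (GiM i.D * Matrix.diagonal fun y => (B6Ineq268MultiLevelBox.W i.D.toDomains y)⁻¹) s s' := by
    have h := CinvTP_ker_eq_ringInverse i
    rw [ringInverse_QGGQs_eq_GiM i.D (one_le_ell i) (toKT i).hMh (toKT i).hP] at h
    have h' := congrFun (congrFun h s) s'
    rw [Matrix.of_apply, Matrix.smul_apply, smul_eq_mul] at h'
    exact h'
  rw [hC, hR, ← liftOpY_mul, LinearMap.smul_apply, Pi.smul_apply, hker, Complex.ofReal_mul, mul_smul]
  congr 1
  exact kernelOpY_deltaY 𝔸 _ s s' E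

end Sockets

/-! ## §8 (v1.1)  ASSEMBLY SOCKETS: the three summand clauses, the `R(1)` clause and the `Q′G′²Q′*(1)` clause FROM the `U = 1` clauses of the covariant
PRIMITIVES (curl, plaquette divergence, gradient, divergence, averages) — what a construction of (3.10)/(3.19)/(3.25)/(3.26) by letters proves about its
own primitives at `U = 1` -/

section Assembly

open Node00 (liftY liftY_apply liftOpY liftOpY_liftY SiteY FBondY BlkY IBondY CfgY BondOpY)
open B9Cor35AtOneInverseLetters (eq_liftOpY_of_ringInverse)

variable {𝔸 : Type} [NormedRing 𝔸] [NormedAlgebra ℂ 𝔸] [CompleteSpace 𝔸]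
variable {d ℓ : ℕ} {hd : 1 ≤ d + 1} {hL : Odd (ℓ + 1) ∧ 1 < ℓ + 1} {b₀ b₁ : ℝ} (i : KIdx d ℓ hd hL b₀ b₁)

omit [CompleteSpace 𝔸] in
/-- product-form lifts of a difference of profiles. [cite: Balaban1985BackgroundPropagators, p.395, bookkeeping (lift calculus)] -/
theorem liftY_sub {X : Type} (f g : X → ℝ) (E : 𝔸) : liftY (f - g) E = liftY f E - liftY g E := by
  funext z
  simp only [liftY_apply, Pi.sub_apply, Complex.ofReal_sub, sub_smul]

omit [CompleteSpace 𝔸] in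
/-- **SUMMAND 1 (`Δ(U) = D*_U D_U` at `U = 1`)**: if `Δ₁ = D* ∘ D` with `D` acting at `U = 1` on product forms as the flat curl `c_f·A(∂p)` and `D*` as the flat
plaquette divergence in print's `Σ_ν` form ((3.9) at `U = 1` = `B8Eq12HodgeLaplacianV1.dcsE_apply`'s right-hand side), then `Δ₁` satisfies the clause `h₁` of
`GA_one_of_summands`. [cite: Balaban1985BackgroundPropagators, (3.9)–(3.10) p.392 (U = 1); Balaban1984PropagatorsII, (2.19) p.226 («∂*∂»)] -/
theorem curlAdjCurl_one_liftY_of_clauses (Δ₁ : (FBondY i → 𝔸) →ₗ[ℂ] (FBondY i → 𝔸))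
    (Dc : (FBondY i → 𝔸) →ₗ[ℂ] (Plaq (PV d ℓ i.m i.K hd hL) 0 → 𝔸)) (Dcs : (Plaq (PV d ℓ i.m i.K hd hL) 0 → 𝔸) →ₗ[ℂ] (FBondY i → 𝔸))
    (hΔ₁ : Δ₁ = Dcs ∘ₗ Dc)
    (hDc : ∀ (A : FBondY i → ℝ) (E : 𝔸), Dc (liftY A E) = liftY (curl i.cf A) E)
    (hDcs : ∀ (F : Plaq (PV d ℓ i.m i.K hd hL) 0 → ℝ) (E : 𝔸), Dcs (liftY F E) =
      liftY (fun b => (∑ ν : Fin (d + 1), if h : ν < b.dir then pdiffAdj i.cf ν (fun z => F ⟨z, ν, b.dir, h⟩) b.src else 0)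
        - ∑ ν : Fin (d + 1), if h : b.dir < ν then pdiffAdj i.cf ν (fun z => F ⟨z, b.dir, ν, h⟩) b.src else 0) E) :
    ∀ (A : FBondY i → ℝ) (E : 𝔸), Δ₁ (liftY A E) = liftY ((onFun (dcsE i.cf) ∘ₗ curlFn i.cf) A) E := by
  intro A E
  rw [hΔ₁, LinearMap.comp_apply, hDc, hDcs]
  congr 1
  funext b
  rw [LinearMap.comp_apply, onFun_apply, B8Eq12HodgeLaplacianV1.dcsE_apply]
  rfl

omit [CompleteSpace 𝔸] in
/-- **SUMMAND 2 (`D_U R(U) D*_U` at `U = 1`)**: if `Δ₂ = D ∘ R ∘ D*` with the site-to-bond `D` acting at `U = 1` as the flat gradient read on the box chart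
(`c_f·(g(toBox b₊) − g(toBox b₋))`), `R` as p21's matrix `rM i.D`, and the bond-to-site `D*` as the flat divergence read on the chart, then `Δ₂` satisfies the
clause `h₂` of `GA_one_of_summands`. [cite: Balaban1985BackgroundPropagators, (3.3), (3.8), (3.25)–(3.26) pp.390–395 (U = 1); Balaban1984PropagatorsII, (2.17), (2.19)] -/
theorem dRds_one_liftY_of_clauses (Δ₂ : (FBondY i → 𝔸) →ₗ[ℂ] (FBondY i → 𝔸))
    (Dg : (SiteY i → 𝔸) →ₗ[ℂ] (FBondY i → 𝔸)) (Rr : (SiteY i → 𝔸) →ₗ[ℂ] (SiteY i → 𝔸)) (Ds : (FBondY i → 𝔸) →ₗ[ℂ] (SiteY i → 𝔸))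
    (hΔ₂ : Δ₂ = Dg ∘ₗ Rr ∘ₗ Ds)
    (hDg : ∀ (g : SiteY i → ℝ) (E : 𝔸), Dg (liftY g E) = liftY (fun b => i.cf * (g (toBox i.hN b.tgt) - g (toBox i.hN b.src))) E)
    (hRr : ∀ (g : SiteY i → ℝ) (E : 𝔸), Rr (liftY g E) = liftY (X := SiteY i) (rM i.D *ᵥ g :) E)
    (hDs : ∀ (A : FBondY i → ℝ) (E : 𝔸), Ds (liftY A E) = liftY (fun z : SiteY i => diverg i.cf A ((boxEquiv i.hN).symm z)) E) :
    ∀ (A : FBondY i → ℝ) (E : 𝔸), Δ₂ (liftY A E) = liftY ((gradFn i.cf ∘ₗ chartOp i.hN (rM i.D) ∘ₗ divFn i.cf) A) E := by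
  intro A E
  rw [hΔ₂, LinearMap.comp_apply, LinearMap.comp_apply, hDs, hRr, hDg]
  rfl

omit [CompleteSpace 𝔸] in
/-- **THE BLOCK LETTER `Q′G′²Q′*` AT `U = 1`**: if `X = Q′ ∘ G′ ∘ G′ ∘ Q′*` with `G′(1)` acting on product forms as `(toKT i).G` (the interface clause
`CovLettersY.Gp_one`, e.g. `Node00.GpY_one_liftY`), `Q′(1)` as p21's weighted block average `QM i.D` and `Q′*(1)` as the block-constant extension `QsM i.D`, then
`X(1)(φ ⊗ E) = (QM·GT·GT·QsM φ) ⊗ E` — the hypothesis `hX` of `C_one_of_ringInverse_QGGQs` and of `R_one_liftY_of_repr325`.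
[cite: Balaban1985BackgroundPropagators, (3.19) p.393, (3.25) p.394, (3.48) p.398 (U = 1); Balaban1984PropagatorsII, (2.17) p.225] -/
theorem QGGQs_one_liftY_of_clauses (X : (BlkY i → 𝔸) →ₗ[ℂ] (BlkY i → 𝔸)) (Gp : (SiteY i → 𝔸) →ₗ[ℂ] (SiteY i → 𝔸))
    (Qp : (SiteY i → 𝔸) →ₗ[ℂ] (BlkY i → 𝔸)) (Qps : (BlkY i → 𝔸) →ₗ[ℂ] (SiteY i → 𝔸))
    (hX : X = Qp ∘ₗ Gp ∘ₗ Gp ∘ₗ Qps)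
    (hGp : ∀ (f : SiteY i → ℝ) (E : 𝔸), Gp (liftY f E) = liftY ((toKT i).G *ᵥ f) E)
    (hQp : ∀ (f : SiteY i → ℝ) (E : 𝔸), Qp (liftY f E) = liftY (QM i.D *ᵥ f) E)
    (hQps : ∀ (φ : BlkY i → ℝ) (E : 𝔸), Qps (liftY φ E) = liftY (X := SiteY i) (QsM i.D *ᵥ φ :) E) :
    ∀ (φ : BlkY i → ℝ) (E : 𝔸), X (liftY φ E) = liftY ((QM i.D * GT i.D * GT i.D * QsM i.D) *ᵥ φ) E := by
  intro φ E
  have hGp' : ∀ (f : SiteY i → ℝ) (E : 𝔸), Gp (liftY f E) = liftY (X := SiteY i) (GT i.D *ᵥ f :) E := fun f E => (hGp f E).trans rfl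
  rw [hX, LinearMap.comp_apply, LinearMap.comp_apply, LinearMap.comp_apply, hQps, hGp', hGp', hQp, Matrix.mulVec_mulVec, Matrix.mulVec_mulVec,
    Matrix.mulVec_mulVec]

omit [CompleteSpace 𝔸] in
/-- **`R(1)` FROM THE (3.25) LETTERS**: if `R = 1 − G′ ∘ Q′* ∘ Ring.inverse (X) ∘ Q′ ∘ G′` with the `U = 1` clauses of `G′`, `Q′`, `Q′*` as above and `X(1)` the block
letter of `QGGQs_one_liftY_of_clauses`, then `R(1)(g ⊗ E) = (rM i.D g) ⊗ E` — the hypothesis `hRr` of `dRds_one_liftY_of_clauses` (the inverse exists at `U = 1`: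
p21's `GiM_mul`). [cite: Balaban1985BackgroundPropagators, (3.25) p.394 (U = 1); Balaban1984PropagatorsII, (2.17) p.225, Prop. 2.3 p.238] -/
theorem R_one_liftY_of_repr325 (Rr Gp : (SiteY i → 𝔸) →ₗ[ℂ] (SiteY i → 𝔸)) (Qp : (SiteY i → 𝔸) →ₗ[ℂ] (BlkY i → 𝔸))
    (Qps : (BlkY i → 𝔸) →ₗ[ℂ] (SiteY i → 𝔸)) (X : (BlkY i → 𝔸) →ₗ[ℂ] (BlkY i → 𝔸))
    (hR : Rr = LinearMap.id - Gp ∘ₗ Qps ∘ₗ Ring.inverse X ∘ₗ Qp ∘ₗ Gp)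
    (hX : ∀ (φ : BlkY i → ℝ) (E : 𝔸), X (liftY φ E) = liftY ((QM i.D * GT i.D * GT i.D * QsM i.D) *ᵥ φ) E)
    (hGp : ∀ (f : SiteY i → ℝ) (E : 𝔸), Gp (liftY f E) = liftY ((toKT i).G *ᵥ f) E)
    (hQp : ∀ (f : SiteY i → ℝ) (E : 𝔸), Qp (liftY f E) = liftY (QM i.D *ᵥ f) E)
    (hQps : ∀ (φ : BlkY i → ℝ) (E : 𝔸), Qps (liftY φ E) = liftY (X := SiteY i) (QsM i.D *ᵥ φ :) E) :
    ∀ (g : SiteY i → ℝ) (E : 𝔸), Rr (liftY g E) = liftY (X := SiteY i) (rM i.D *ᵥ g :) E := by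
  intro g E
  have hinv : Ring.inverse X = liftOpY 𝔸 (GiM i.D) :=
    eq_liftOpY_of_ringInverse rfl (GiM_mul i.D (one_le_ell i) (toKT i).hMh (toKT i).hP).2 hX
  have hGp' : ∀ (f : SiteY i → ℝ) (E : 𝔸), Gp (liftY f E) = liftY (X := SiteY i) (GT i.D *ᵥ f :) E := fun f E => (hGp f E).trans rfl
  rw [hR, LinearMap.sub_apply, LinearMap.id_apply, LinearMap.comp_apply, LinearMap.comp_apply, LinearMap.comp_apply, LinearMap.comp_apply, hGp', hQp,
    hinv, liftOpY_liftY, hQps, hGp', ← liftY_sub]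
  congr 1
  rw [rM, pM, Matrix.sub_mulVec, Matrix.one_mulVec, ← Matrix.mulVec_mulVec, ← Matrix.mulVec_mulVec, ← Matrix.mulVec_mulVec, ← Matrix.mulVec_mulVec]
  rfl

omit [CompleteSpace 𝔸] in
/-- **SUMMAND 3 (`Q*(U)aQ(U)` at `U = 1`)**: if `Δ₃ = Q* ∘ a ∘ Q` with `Q(1)` acting on product forms as the multi-scale straight bond average `(Q_jA)(β)`, `a` as the
weight `w`, and `Q*(1)` as the transposed kernel `Σ_n Q(n, b)ω_n`, then `Δ₃` satisfies the clause `h₃` of `GA_one_of_summands`.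
[cite: Balaban1985BackgroundPropagators, (3.16) p.393, (3.26) p.395 (U = 1); Balaban1984PropagatorsII, (2.18)–(2.20) p.226] -/
theorem QaQ_one_liftY_of_clauses (Δ₃ : (FBondY i → 𝔸) →ₗ[ℂ] (FBondY i → 𝔸))
    (Q : (FBondY i → 𝔸) →ₗ[ℂ] (IBondY i → 𝔸)) (a : (IBondY i → 𝔸) →ₗ[ℂ] (IBondY i → 𝔸)) (Qs : (IBondY i → 𝔸) →ₗ[ℂ] (FBondY i → 𝔸))
    (hΔ₃ : Δ₃ = Qs ∘ₗ a ∘ₗ Q)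
    (hQ : ∀ (A : FBondY i → ℝ) (E : 𝔸), Q (liftY A E) = liftY (fun n => bondAvgIter (n.1.1 : ℕ) A n.1.2) E)
    (ha : ∀ (ω : IBondY i → ℝ) (E : 𝔸), a (liftY ω E) = liftY (fun n => i.w n * ω n) E)
    (hQs : ∀ (ω : IBondY i → ℝ) (E : 𝔸), Qs (liftY ω E) =
      liftY (fun b => ∑ n : IBondY i, bondAvgIter (n.1.1 : ℕ) (Pi.single b (1 : ℝ)) n.1.2 * ω n) E) :
    ∀ (A : FBondY i → ℝ) (E : 𝔸), Δ₃ (liftY A E) = liftY ((onFun (QsE (domT i.hN i.D i.hk)) ∘ₗ diagFn i.w ∘ₗ qFn (domT i.hN i.D i.hk)) A) E := by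
  intro A E
  rw [hΔ₃, LinearMap.comp_apply, LinearMap.comp_apply, hQ, ha, hQs]
  congr 1
  funext b
  rw [LinearMap.comp_apply, LinearMap.comp_apply, onFun_QsE_apply]
  rfl

end Assembly

end Literature.MathematicalPhysics.QuantumFieldTheory.Balaban1983to89.B9Eq326AtOneChart

end
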